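import Summits.ValiantsHypothesis.ValiantsHypothesis.Theorems.LacunarySymmetroidMatrixDescartesFiniteSectorArrowEstimates

/-!
# `MatrixDescartes` — line «finite» / «stamp»: SCALAR ESTIMATES and the SIGN READINGS for the two-hub design on `(0,1,4)`
# (the inequalities behind the certificate of `…FiniteSectorLadderFour`)

HONEST FRAMING.  Object-search cell `pub-symmetroid`, seat val-sym-eng-3 g11 (census/instrument ENGINE #3 of D-0148 (b)).
HELPER of the crux item `stmt-ValiantsHypothesis-18050`
(`Summit.ValiantsHypothesis.ValiantsHypothesis.Theses.LacunarySymmetroid.MatrixDescartes`, asymptotic in `K`) with NO closure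
claim; no census constant is named here (elementary real inequalities only).  Nothing here bears on the crux or on `VP ≠ VNP`.

THE MECHANISM.  The Schur function of the design (`…FiniteSectorTwoHubDesign`) is
`g(t) = −(1 − t/(2B^{14M+9}))² + (t/B^{11} − 1) · ∑_k H_k(t)`, `H_k(t) = (B/B^{7k} − t/B^{21k+12})² / (1 + t⁴/B^{56(k+1)}) ≥ 0`:
a non-positive hub square plus the total leaf mass weighted by `w(t) = t/B^{11} − 1`, which is negative before `B^{11}` and positive
after.  Each leaf term has a plateau `≤ B²/B^{14k}` up to its dip `t = B^{14k+13}` where it vanishes, and decays like `B^{14k+32}/t²`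
beyond (`hubLeaf_plateau` / `_dip_zero` / `_decay`); weighted, it reads `≥ 2` at `B^{14k+12}` and `B^{14k+15}` (`hubLeaf_ref_pre` /
`_ref_post`) and every OTHER leaf reads `≤ 1/B` at the dips `B^{14k+13}` and the bridges `B^{14k+22}` (`hubLeaf_above_small` /
`_below_small`).  Hence (§3) `g < 0` at `B⁹` (`twoHubSign_first`), `g > 0, < 0, > 0, < 0` at `B^{14k+12}, B^{14k+13}, B^{14k+15},
B^{14k+22}` (`twoHubSign_pre/dip/post/bridge`, using `twoHub_pos_of_big` / `twoHub_neg_of_small` with `4M < B`), `g > 0` at the hub's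
own dip `t = 2B^{14M+9}` where the square vanishes (`twoHubSign_finalDip`, needs one leaf) and `g < 0` at `B^{14M+24}`
(`twoHubSign_last`): `4M + 3` alternating readings.
[folklore] Elementary real inequalities; no citation is load-bearing.
-/

-- `Summit.ValiantsHypothesis.ValiantsHypothesis.…` repeats a component by the D-0017 layout
-- (single-conjunct summit), which the `dupNamespace` linter flags; the name is mandated.
set_option linter.dupNamespace false

namespace Summit.ValiantsHypothesis.ValiantsHypothesis.Theorems.LacunarySymmetroidMatrixDescartes.FiniteSector

open scoped BigOperators Matrix
open Polynomial Finset Matrix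

/-! ## §2 Scalar estimates for the two-hub design (base `B ≥ 16`, `B > 4M`) -/

/-- The quartic leaf term `H_k(t) = (B/B^{7k} − t/B^{21k+12})² / (1 + t⁴/B^{56(k+1)})` (local notation, no definition). -/
local notation3 (prettyPrint := false) "H[" B ", " k "](" t ")" =>
  (((B : ℝ) / (B : ℝ) ^ (7 * (k : ℕ)) - (t : ℝ) / (B : ℝ) ^ (21 * (k : ℕ) + 12)) ^ 2
    / (1 + (t : ℝ) ^ 4 / (B : ℝ) ^ (56 * ((k : ℕ) + 1))))

/-- PLATEAU: for `0 ≤ t ≤ B^{14k+13}` the quartic leaf term is `≤ B²/B^{14k}`. [folklore] -/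
theorem hubLeaf_plateau {B t : ℝ} (hB : 1 ≤ B) (k : ℕ) (ht0 : 0 ≤ t) (ht : t ≤ B ^ (14 * k + 13)) :
    H[B, k](t) ≤ B ^ 2 / B ^ (14 * k) := by
  have hB0 : 0 < B := by linarith
  have hden : 1 ≤ 1 + t ^ 4 / B ^ (56 * (k + 1)) := le_add_of_nonneg_right (by positivity)
  have hb0 : 0 ≤ B / B ^ (7 * k) - t / B ^ (21 * k + 12) := by
    rw [sub_nonneg, div_le_div_iff₀ (by positivity) (by positivity)]
    calc t * B ^ (7 * k) ≤ B ^ (14 * k + 13) * B ^ (7 * k) := mul_le_mul_of_nonneg_right ht (by positivity)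
      _ = B * B ^ (21 * k + 12) := by rw [← pow_add, ← pow_succ']; ring_nf
  have hb1 : B / B ^ (7 * k) - t / B ^ (21 * k + 12) ≤ B / B ^ (7 * k) := sub_le_self _ (by positivity)
  calc H[B, k](t) ≤ (B / B ^ (7 * k) - t / B ^ (21 * k + 12)) ^ 2 := div_le_self (by positivity) hden
    _ ≤ (B / B ^ (7 * k)) ^ 2 := pow_le_pow_left₀ hb0 hb1 2
    _ = B ^ 2 / B ^ (14 * k) := by rw [div_pow, ← pow_mul]; ring_nf

/-- DECAY: for `t ≥ B^{14k+13}` the quartic leaf term is `≤ B^{14k+32}/t²`. [folklore] -/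
theorem hubLeaf_decay {B t : ℝ} (hB : 1 ≤ B) (k : ℕ) (ht : B ^ (14 * k + 13) ≤ t) :
    H[B, k](t) ≤ B ^ (14 * k + 32) / t ^ 2 := by
  have hB0 : 0 < B := by linarith
  have ht0 : 0 < t := lt_of_lt_of_le (by positivity) ht
  have hsq : (B / B ^ (7 * k) - t / B ^ (21 * k + 12)) ^ 2 ≤ t ^ 2 / (B ^ (21 * k + 12)) ^ 2 := by
    have hx : B / B ^ (7 * k) - t / B ^ (21 * k + 12) = (B ^ (14 * k + 13) - t) / B ^ (21 * k + 12) := by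
      have hsplit : B ^ (21 * k + 12) = B ^ (7 * k) * B ^ (14 * k + 12) := by rw [← pow_add]; ring_nf
      rw [div_sub_div _ _ (by positivity) (by positivity), div_eq_div_iff (by positivity) (by positivity), hsplit,
        show B ^ (14 * k + 13) = B ^ (14 * k + 12) * B by rw [pow_succ]]
      ring
    rw [hx, div_pow, div_le_div_iff₀ (by positivity) (by positivity)]
    have h1 : (B ^ (14 * k + 13) - t) ^ 2 ≤ t ^ 2 := by nlinarith [pow_pos hB0 (14 * k + 13)]
    exact mul_le_mul_of_nonneg_right h1 (by positivity)
  have hden : t ^ 4 / B ^ (56 * (k + 1)) ≤ 1 + t ^ 4 / B ^ (56 * (k + 1)) := le_add_of_nonneg_left zero_le_one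
  calc H[B, k](t) ≤ (t ^ 2 / (B ^ (21 * k + 12)) ^ 2) / (t ^ 4 / B ^ (56 * (k + 1))) :=
        div_le_div₀ (by positivity) hsq (by positivity) hden
    _ = B ^ (14 * k + 32) / t ^ 2 := by
        rw [div_div_div_eq, div_eq_div_iff (by positivity) (by positivity), ← pow_mul,
          show 56 * (k + 1) = (21 * k + 12) * 2 + (14 * k + 32) by ring, pow_add]
        ring

/-- DIP: at `t = B^{14k+13}` the `k`-th quartic leaf term vanishes. [folklore] -/
theorem hubLeaf_dip_zero {B : ℝ} (hB : 0 < B) (k : ℕ) : H[B, k](B ^ (14 * k + 13)) = 0 := by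
  have : B / B ^ (7 * k) - B ^ (14 * k + 13) / B ^ (21 * k + 12) = 0 := by
    rw [sub_eq_zero, div_eq_div_iff (by positivity) (by positivity), ← pow_succ', ← pow_add]
    ring_nf
  rw [this]; simp

/-- PRE-DIP READING: at `t = B^{14k+12}` (`B ≥ 8`), `(t/B^{11} − 1)·H_k(t) ≥ 2`. [folklore] -/
theorem hubLeaf_ref_pre {B : ℝ} (hB : 8 ≤ B) (k : ℕ) :
    2 ≤ (B ^ (14 * k + 12) / B ^ 11 - 1) * H[B, k](B ^ (14 * k + 12)) := by
  have hB0 : 0 < B := by linarith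
  have hw : B ^ (14 * k + 12) / B ^ 11 = B ^ (14 * k + 1) := by
    field_simp; ring
  have hb : B / B ^ (7 * k) - B ^ (14 * k + 12) / B ^ (21 * k + 12) = (B - 1) / B ^ (7 * k) := by
    rw [div_sub_div _ _ (by positivity) (by positivity), div_eq_div_iff (by positivity) (by positivity)]
    rw [show B ^ (21 * k + 12) = B ^ (7 * k) * B ^ (14 * k + 12) by rw [← pow_add]; ring_nf]
    ring
  have hd : (B ^ (14 * k + 12)) ^ 4 / B ^ (56 * (k + 1)) = 1 / B ^ 8 := by
    rw [div_eq_div_iff (by positivity) (by positivity), one_mul, ← pow_mul, ← pow_add]; ring_nf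
  rw [hw, hb, hd, div_pow, ← pow_mul, show 7 * k * 2 = 14 * k by ring]
  set X : ℝ := B ^ (14 * k) with hX
  have hX0 : 0 < X := by positivity
  have hX1 : 1 ≤ X := one_le_pow₀ (by linarith)
  have hk : X * (B - 1) ≤ B ^ (14 * k + 1) - 1 := by
    rw [pow_succ, ← hX]; nlinarith
  have h8 : 1 / B ^ 8 ≤ 1 := by rw [div_le_one (by positivity)]; exact one_le_pow₀ (by linarith)
  have hcube : (343 : ℝ) ≤ (B - 1) ^ 3 := by
    have h7 : (7 : ℝ) ≤ B - 1 := by linarith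
    have := pow_le_pow_left₀ (by norm_num) h7 3
    norm_num at this; linarith
  calc (2 : ℝ) ≤ (B - 1) ^ 3 / 2 := by linarith
    _ ≤ (B - 1) ^ 3 / (1 + 1 / B ^ 8) := div_le_div_of_nonneg_left (by positivity) (by positivity) (by linarith)
    _ = (X * (B - 1)) * ((B - 1) ^ 2 / X / (1 + 1 / B ^ 8)) := by field_simp
    _ ≤ (B ^ (14 * k + 1) - 1) * ((B - 1) ^ 2 / X / (1 + 1 / B ^ 8)) :=
        mul_le_mul_of_nonneg_right hk (by positivity)

/-- POST-DIP READING: at `t = B^{14k+15}` (`B ≥ 2`), `(t/B^{11} − 1)·H_k(t) ≥ 2`. [folklore] -/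
theorem hubLeaf_ref_post {B : ℝ} (hB : 2 ≤ B) (k : ℕ) :
    2 ≤ (B ^ (14 * k + 15) / B ^ 11 - 1) * H[B, k](B ^ (14 * k + 15)) := by
  have hB0 : 0 < B := by linarith
  have hw : B ^ (14 * k + 15) / B ^ 11 = B ^ (14 * k + 4) := by
    field_simp; ring
  have hb : B / B ^ (7 * k) - B ^ (14 * k + 15) / B ^ (21 * k + 12) = (B - B ^ 3) / B ^ (7 * k) := by
    rw [div_sub_div _ _ (by positivity) (by positivity), div_eq_div_iff (by positivity) (by positivity)]
    rw [show B ^ (21 * k + 12) = B ^ (7 * k) * B ^ (14 * k + 12) by rw [← pow_add]; ring_nf,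
      show B ^ (14 * k + 15) = B ^ (14 * k + 12) * B ^ 3 by rw [← pow_add]]
    ring
  have hd : (B ^ (14 * k + 15)) ^ 4 / B ^ (56 * (k + 1)) = B ^ 4 := by
    rw [div_eq_iff (by positivity), ← pow_mul, ← pow_add]; ring_nf
  rw [hw, hb, hd, div_pow, ← pow_mul, show 7 * k * 2 = 14 * k by ring]
  set X : ℝ := B ^ (14 * k) with hX
  have hX0 : 0 < X := by positivity
  have hX1 : 1 ≤ X := one_le_pow₀ (by linarith)
  have hB4 : (16 : ℝ) ≤ B ^ 4 := by nlinarith [pow_le_pow_left₀ (by norm_num : (0:ℝ) ≤ 2) hB 4]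
  have hk : X * (B ^ 4 - 1) ≤ B ^ (14 * k + 4) - 1 := by
    rw [pow_add, ← hX]; nlinarith
  have hB3 : (6 : ℝ) ≤ B ^ 3 - B := by
    have hB2 : (3 : ℝ) ≤ B ^ 2 - 1 := by nlinarith
    have hrw : B ^ 3 - B = B * (B ^ 2 - 1) := by ring
    rw [hrw]; nlinarith
  have h36 : (36 : ℝ) ≤ (B - B ^ 3) ^ 2 := by nlinarith
  have hprod : (B ^ 4 - 1) * 36 ≤ (B ^ 4 - 1) * (B - B ^ 3) ^ 2 := mul_le_mul_of_nonneg_left h36 (by linarith)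
  calc (2 : ℝ) ≤ (B ^ 4 - 1) * (B - B ^ 3) ^ 2 / (1 + B ^ 4) := by
        rw [le_div_iff₀ (by positivity)]; nlinarith
    _ = (X * (B ^ 4 - 1)) * ((B - B ^ 3) ^ 2 / X / (1 + B ^ 4)) := by field_simp
    _ ≤ (B ^ (14 * k + 4) - 1) * ((B - B ^ 3) ^ 2 / X / (1 + B ^ 4)) :=
        mul_le_mul_of_nonneg_right hk (by positivity)


/-! ## §3 The sign certificate of `g(t) = −(1 − t/(2B^{14M+9}))² + (t/B^{11} − 1)·∑_k H_k(t)` -/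

/-- The Schur function `g` of the two-hub design (local notation, no definition). -/
local notation3 (prettyPrint := false) "gg[" B ", " M "](" t ")" =>
  (-(1 - (t : ℝ) / (2 * (B : ℝ) ^ (14 * (M : ℕ) + 9))) ^ 2
    + ((t : ℝ) / (B : ℝ) ^ 11 - 1) * ∑ j : Fin (M : ℕ), H[B, j](t))

/-- NEGATIVE READINGS (abstract): if the hub square is `≥ ¼` and every weighted leaf term is `≤ 1/B` with `4M < B`,
then `g < 0`. [folklore] -/
theorem twoHub_neg_of_small {M : ℕ} {B t : ℝ} (hB0 : 0 < B) (hMB : 4 * (M : ℝ) < B)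
    (hsq : 1 / 4 ≤ (1 - t / (2 * B ^ (14 * M + 9))) ^ 2)
    (hsmall : ∀ j : Fin M, (t / B ^ 11 - 1) * H[B, j](t) ≤ 1 / B) : gg[B, M](t) < 0 := by
  rw [Finset.mul_sum]
  have h1 : ∑ j : Fin M, (t / B ^ 11 - 1) * H[B, j](t) ≤ (M : ℝ) * (1 / B) := by
    have := Finset.sum_le_card_nsmul univ _ (1 / B) fun j _ => hsmall j
    rwa [card_univ, Fintype.card_fin, nsmul_eq_mul] at this
  have h2 : (M : ℝ) * (1 / B) < 1 / 4 := by
    rw [← mul_div_assoc, mul_one, div_lt_iff₀ hB0]; linarith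
  linarith

/-- POSITIVE READINGS (abstract): if the hub square is `≤ 1`, the weight `t/B^{11} − 1 ≥ 0` and ONE weighted leaf term is
`≥ 2`, then `g > 0`. [folklore] -/
theorem twoHub_pos_of_big {M : ℕ} {B t : ℝ} (hB0 : 0 < B) (k : Fin M)
    (hsq : (1 - t / (2 * B ^ (14 * M + 9))) ^ 2 ≤ 1) (hw : 0 ≤ t / B ^ 11 - 1)
    (hbig : 2 ≤ (t / B ^ 11 - 1) * H[B, k](t)) : 0 < gg[B, M](t) := by
  rw [Finset.mul_sum, ← Finset.add_sum_erase univ _ (mem_univ k)]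
  have h1 : 0 ≤ ∑ j ∈ univ.erase k, (t / B ^ 11 - 1) * H[B, j](t) :=
    Finset.sum_nonneg fun j _ => mul_nonneg hw (by positivity)
  linarith

/-- The hub square is `≤ 1` for `0 ≤ t ≤ 4·B^{14M+9}` and `≥ ¼` for `0 ≤ t ≤ B^{14M+9}`. [folklore] -/
theorem twoHub_sq_bounds {M : ℕ} {B t : ℝ} (hB0 : 0 < B) (ht0 : 0 ≤ t) :
    (t ≤ 4 * B ^ (14 * M + 9) → (1 - t / (2 * B ^ (14 * M + 9))) ^ 2 ≤ 1) ∧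
      (t ≤ B ^ (14 * M + 9) → 1 / 4 ≤ (1 - t / (2 * B ^ (14 * M + 9))) ^ 2) := by
  have hP : 0 < 2 * B ^ (14 * M + 9) := by positivity
  constructor
  · intro ht
    have hx : t / (2 * B ^ (14 * M + 9)) ≤ 2 := by rw [div_le_iff₀ hP]; linarith
    have hx0 : 0 ≤ t / (2 * B ^ (14 * M + 9)) := by positivity
    nlinarith
  · intro ht
    have hx : t / (2 * B ^ (14 * M + 9)) ≤ 1 / 2 := by rw [div_le_iff₀ hP]; linarith
    have hx0 : 0 ≤ t / (2 * B ^ (14 * M + 9)) := by positivity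
    nlinarith

/-- A quartic leaf ABOVE the current scale (plateau), weighted: `(t/B^{11} − 1)·H_j(t) ≤ 1/B` when `0 ≤ t ≤ B^n`,
`n ≤ 14j + 13` and `n + 2 + 1 ≤ 11 + 14j`. [folklore] -/
theorem hubLeaf_above_small {B t : ℝ} (hB : 1 ≤ B) (j : ℕ) {n : ℕ} (ht0 : 0 ≤ t) (ht : t ≤ B ^ n)
    (hn : n ≤ 14 * j + 13) (he : n + 3 ≤ 11 + 14 * j) : (t / B ^ 11 - 1) * H[B, j](t) ≤ 1 / B := by
  have hB0 : 0 < B := by linarith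
  have hH0 : 0 ≤ H[B, j](t) := by positivity
  have hHle : H[B, j](t) ≤ B ^ 2 / B ^ (14 * j) :=
    hubLeaf_plateau hB j ht0 (ht.trans (pow_le_pow_right₀ hB hn))
  have hw : t / B ^ 11 - 1 ≤ B ^ n / B ^ 11 := by
    have : t / B ^ 11 ≤ B ^ n / B ^ 11 := div_le_div_of_nonneg_right ht (by positivity)
    linarith
  calc (t / B ^ 11 - 1) * H[B, j](t) ≤ (B ^ n / B ^ 11) * (B ^ 2 / B ^ (14 * j)) := by
        nlinarith [mul_nonneg (sub_nonneg.2 (le_refl (0:ℝ))) hH0, hHle, hw,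
          div_nonneg (pow_nonneg hB0.le n) (pow_nonneg hB0.le 11), mul_le_mul hw hHle hH0 (by positivity)]
    _ = B ^ (n + 2) / B ^ (11 + 14 * j) := by rw [div_mul_div_comm, ← pow_add, ← pow_add]
    _ ≤ 1 / B ^ 1 := pow_div_pow_le_one_div hB (by omega)
    _ = 1 / B := by rw [pow_one]

/-- A quartic leaf BELOW the current scale (decayed), weighted: `(t/B^{11} − 1)·H_j(t) ≤ 1/B` when `t = B^n`,
`14j + 13 ≤ n` and `14j + 32 + 1 ≤ 11 + n`. [folklore] -/
theorem hubLeaf_below_small {B : ℝ} (hB : 1 ≤ B) (j : ℕ) {n : ℕ} (hn : 14 * j + 13 ≤ n)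
    (he : 14 * j + 33 ≤ 11 + n) : (B ^ n / B ^ 11 - 1) * H[B, j](B ^ n) ≤ 1 / B := by
  have hB0 : 0 < B := by linarith
  have hH0 : 0 ≤ H[B, j](B ^ n) := by positivity
  have hHle : H[B, j](B ^ n) ≤ B ^ (14 * j + 32) / (B ^ n) ^ 2 := hubLeaf_decay hB j (pow_le_pow_right₀ hB hn)
  have hw : B ^ n / B ^ 11 - 1 ≤ B ^ n / B ^ 11 := by linarith
  calc (B ^ n / B ^ 11 - 1) * H[B, j](B ^ n) ≤ (B ^ n / B ^ 11) * (B ^ (14 * j + 32) / (B ^ n) ^ 2) :=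
        mul_le_mul hw hHle hH0 (by positivity)
    _ = B ^ (n + (14 * j + 32)) / B ^ (11 + (n + n)) := by
        rw [div_mul_div_comm, ← pow_add, sq, ← pow_add, ← pow_add]
    _ ≤ 1 / B ^ 1 := pow_div_pow_le_one_div hB (by omega)
    _ = 1 / B := by rw [pow_one]

/-- **First reading** (`t = B^9`, before the affine node changes sign): `g < 0` — every term is non-positive and the hub
square is positive. [folklore] -/
theorem twoHubSign_first (M : ℕ) {B : ℝ} (hB : 2 ≤ B) : gg[B, M](B ^ 9) < 0 := by
  have hB0 : 0 < B := by linarith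
  have hw : B ^ 9 / B ^ 11 - 1 < 0 := by
    rw [sub_neg, div_lt_one (by positivity)]
    exact pow_lt_pow_right₀ (by linarith) (by norm_num)
  have hsum : 0 ≤ ∑ j : Fin M, H[B, j](B ^ 9) := Finset.sum_nonneg fun j _ => by positivity
  have hsq : 0 < (1 - B ^ 9 / (2 * B ^ (14 * M + 9))) ^ 2 := by
    have : B ^ 9 / (2 * B ^ (14 * M + 9)) < 1 := by
      rw [div_lt_one (by positivity)]
      have : B ^ 9 ≤ B ^ (14 * M + 9) := pow_le_pow_right₀ (by linarith) (by omega)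
      nlinarith [pow_pos hB0 (14 * M + 9)]
    nlinarith
  nlinarith [mul_nonpos_of_nonpos_of_nonneg hw.le hsum]

/-- **Pre-dip reading** of leaf `k` (`t = B^{14k+12}`): `g > 0`. [folklore] -/
theorem twoHubSign_pre {M : ℕ} {B : ℝ} (hB : 8 ≤ B) (k : Fin M) : 0 < gg[B, M](B ^ (14 * (k : ℕ) + 12)) := by
  have hB0 : 0 < B := by linarith
  have hB1 : 1 ≤ B := by linarith
  have hk := k.isLt
  refine twoHub_pos_of_big hB0 k ((twoHub_sq_bounds hB0 (by positivity)).1 ?_) ?_ (hubLeaf_ref_pre hB k)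
  · calc B ^ (14 * (k : ℕ) + 12) ≤ B ^ (14 * M + 9) := pow_le_pow_right₀ hB1 (by omega)
      _ ≤ 4 * B ^ (14 * M + 9) := by nlinarith [pow_pos hB0 (14 * M + 9)]
  · rw [sub_nonneg, le_div_iff₀ (by positivity), one_mul]
    exact pow_le_pow_right₀ hB1 (by omega)

/-- **Post-dip reading** of leaf `k` (`t = B^{14k+15}`): `g > 0`. [folklore] -/
theorem twoHubSign_post {M : ℕ} {B : ℝ} (hB : 8 ≤ B) (k : Fin M) : 0 < gg[B, M](B ^ (14 * (k : ℕ) + 15)) := by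
  have hB0 : 0 < B := by linarith
  have hB1 : 1 ≤ B := by linarith
  have hk := k.isLt
  refine twoHub_pos_of_big hB0 k ((twoHub_sq_bounds hB0 (by positivity)).1 ?_) ?_ (hubLeaf_ref_post (by linarith) k)
  · calc B ^ (14 * (k : ℕ) + 15) ≤ B ^ (14 * M + 9) := pow_le_pow_right₀ hB1 (by omega)
      _ ≤ 4 * B ^ (14 * M + 9) := by nlinarith [pow_pos hB0 (14 * M + 9)]
  · rw [sub_nonneg, le_div_iff₀ (by positivity), one_mul]
    exact pow_le_pow_right₀ hB1 (by omega)

/-- **Dip reading** of leaf `k` (`t = B^{14k+13}`): `g < 0` — the `k`-th term vanishes, every other weighted leaf term is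
`≤ 1/B`, the hub square is `≥ ¼`. [folklore] -/
theorem twoHubSign_dip {M : ℕ} {B : ℝ} (hB : 8 ≤ B) (hMB : 4 * (M : ℝ) < B) (k : Fin M) :
    gg[B, M](B ^ (14 * (k : ℕ) + 13)) < 0 := by
  have hB0 : 0 < B := by linarith
  have hB1 : 1 ≤ B := by linarith
  have hk := k.isLt
  refine twoHub_neg_of_small hB0 hMB ((twoHub_sq_bounds hB0 (by positivity)).2 (pow_le_pow_right₀ hB1 (by omega)))
    fun j => ?_
  rcases Nat.lt_trichotomy (j : ℕ) (k : ℕ) with hjk | hjk | hjk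
  · exact hubLeaf_below_small hB1 j (by omega) (by omega)
  · rw [hjk, hubLeaf_dip_zero hB0, mul_zero]; positivity
  · exact hubLeaf_above_small hB1 j (by positivity) le_rfl (by omega) (by omega)

/-- **Bridge reading** after leaf `k` (`t = B^{14k+22}`, the hub's constant carries the sign): `g < 0`. [folklore] -/
theorem twoHubSign_bridge {M : ℕ} {B : ℝ} (hB : 8 ≤ B) (hMB : 4 * (M : ℝ) < B) (k : Fin M) :
    gg[B, M](B ^ (14 * (k : ℕ) + 22)) < 0 := by
  have hB0 : 0 < B := by linarith
  have hB1 : 1 ≤ B := by linarith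
  have hk := k.isLt
  refine twoHub_neg_of_small hB0 hMB ((twoHub_sq_bounds hB0 (by positivity)).2 (pow_le_pow_right₀ hB1 (by omega)))
    fun j => ?_
  rcases Nat.lt_or_ge (k : ℕ) (j : ℕ) with hjk | hjk
  · exact hubLeaf_above_small hB1 j (by positivity) le_rfl (by omega) (by omega)
  · exact hubLeaf_below_small hB1 j (by omega) (by omega)

/-- **Final dip** (`t = 2·B^{14M+9}`, where the hub square `(1 − θt/2)²` vanishes): `g > 0` as soon as there is a leaf
(`M ≥ 1`) — the weight is positive and the last leaf's term does not vanish there. [folklore] -/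
theorem twoHubSign_finalDip {M : ℕ} (hM : 1 ≤ M) {B : ℝ} (hB : 2 ≤ B) : 0 < gg[B, M](2 * B ^ (14 * M + 9)) := by
  have hB0 : 0 < B := by linarith
  have hsq : (1 - 2 * B ^ (14 * M + 9) / (2 * B ^ (14 * M + 9))) ^ 2 = 0 := by
    rw [div_self (by positivity)]; ring
  rw [hsq, neg_zero, zero_add]
  refine mul_pos ?_ ?_
  · rw [sub_pos, lt_div_iff₀ (by positivity), one_mul]
    calc B ^ 11 ≤ B ^ (14 * M + 9) := pow_le_pow_right₀ (by linarith) (by omega)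
      _ < 2 * B ^ (14 * M + 9) := by linarith [pow_pos hB0 (14 * M + 9)]
  · obtain ⟨k, hk⟩ : ∃ k : ℕ, k + 1 = M := ⟨M - 1, by omega⟩
    have hkM : k < M := by omega
    have hne : B / B ^ (7 * k) - 2 * B ^ (14 * M + 9) / B ^ (21 * k + 12) ≠ 0 := by
      rw [sub_ne_zero, Ne, div_eq_div_iff (by positivity) (by positivity)]
      intro h
      have h1 : B * B ^ (21 * k + 12) = B ^ (7 * k) * B ^ (14 * k + 13) := by rw [← pow_succ', ← pow_add]; ring_nf
      have h2 : 2 * B ^ (14 * M + 9) * B ^ (7 * k) = B ^ (7 * k) * (2 * B ^ (14 * k + 23)) := by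
        rw [← hk]; ring_nf
      rw [h1, h2] at h
      have h3 : B ^ (14 * k + 13) = 2 * B ^ (14 * k + 23) := mul_left_cancel₀ (by positivity) h
      have h4 : B ^ (14 * k + 13) < B ^ (14 * k + 23) := pow_lt_pow_right₀ (by linarith) (by omega)
      nlinarith [pow_pos hB0 (14 * k + 23)]
    have hlast : 0 < H[B, k](2 * B ^ (14 * M + 9)) :=
      div_pos (lt_of_le_of_ne (sq_nonneg _) (Ne.symm (pow_ne_zero 2 hne))) (by positivity)
    have hle : H[B, k](2 * B ^ (14 * M + 9)) ≤ ∑ j : Fin M, H[B, j](2 * B ^ (14 * M + 9)) :=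
      Finset.single_le_sum (f := fun j : Fin M => H[B, j](2 * B ^ (14 * M + 9))) (fun j _ => by positivity)
        (mem_univ (⟨k, hkM⟩ : Fin M))
    exact lt_of_lt_of_le hlast hle

/-- **Last reading** (`t = B^{14M+24}`, past the final dip): `g < 0` — the hub square `(B^{15}/2 − 1)²` beats the
decayed leaves. [folklore] -/
theorem twoHubSign_last (M : ℕ) {B : ℝ} (hB : 8 ≤ B) (hMB : 4 * (M : ℝ) < B) : gg[B, M](B ^ (14 * M + 24)) < 0 := by
  have hB0 : 0 < B := by linarith
  have hB1 : 1 ≤ B := by linarith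
  have hx : B ^ (14 * M + 24) / (2 * B ^ (14 * M + 9)) = B ^ 15 / 2 := by
    rw [div_eq_div_iff (by positivity) (by norm_num), pow_add]; ring
  have hsq : (4 : ℝ) ≤ (1 - B ^ (14 * M + 24) / (2 * B ^ (14 * M + 9))) ^ 2 := by
    rw [hx]
    have : (8 : ℝ) ≤ B ^ 15 := le_trans hB (le_self_pow₀ hB1 (by norm_num))
    nlinarith
  have hsmall : ∀ j : Fin M, (B ^ (14 * M + 24) / B ^ 11 - 1) * H[B, j](B ^ (14 * M + 24)) ≤ 1 / B := fun j =>
    hubLeaf_below_small hB1 j (by have := j.isLt; omega) (by have := j.isLt; omega)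
  have h1 : ∑ j : Fin M, (B ^ (14 * M + 24) / B ^ 11 - 1) * H[B, j](B ^ (14 * M + 24)) ≤ (M : ℝ) * (1 / B) := by
    have := Finset.sum_le_card_nsmul univ _ (1 / B) fun j _ => hsmall j
    rwa [card_univ, Fintype.card_fin, nsmul_eq_mul] at this
  have h2 : (M : ℝ) * (1 / B) < 1 / 4 := by
    rw [← mul_div_assoc, mul_one, div_lt_iff₀ hB0]; linarith
  rw [Finset.mul_sum]
  linarith





end Summit.ValiantsHypothesis.ValiantsHypothesis.Theorems.LacunarySymmetroidMatrixDescartes.FiniteSector
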